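import Summits.ResolutionOfSingularities.ResolutionOfSingularities.Theses.WeightedInvariant
import Literature.AlgebraicGeometry.Resolution.WeightedResolutionDatum
import Literature.AlgebraicGeometry.Resolution.CobordantBlowupFiltration
import Summits.ResolutionOfSingularities.ResolutionOfSingularities.Theorems.WeightedInvariantWeightedConstructionExtReesBridge
import Summits.ResolutionOfSingularities.ResolutionOfSingularities.Theorems.WeightedInvariantWeightedConstructionCobordantBlowupRegular
import Summits.ResolutionOfSingularities.ResolutionOfSingularities.Theorems.WeightedInvariantWeightedConstructionCobordantPlusSmooth
import Summits.ResolutionOfSingularities.ResolutionOfSingularities.Theorems.WeightedInvariantWeightedConstructionOffExceptional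
import Summits.ResolutionOfSingularities.ResolutionOfSingularities.Theorems.WeightedInvariantWeightedConstructionSingularLocusClosed
import Summits.ResolutionOfSingularities.ResolutionOfSingularities.Theorems.WeightedInvariantWeightedConstructionSingularLocusComap

/-!
# Line `support-first-weights-second` for crux `WeightedConstruction` (stmt-ResolutionOfSingularities-0571)

Lead's skeleton (`work/WeightedConstruction.lean`, published as
`Cruxes/WeightedConstruction/Lines/support_first_weights_second.lean`).

RESHAPE NOTE. The planner's checked skeleton (evidence `20260816T051840Z-line-support-first-weights-second.lean`,
sha 5349794d67cd) is not mounted in a lead's jail and its two load-bearing structures (`WeightRule p`,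
`SupportFirstInvariant p W`) are not recoverable from the ledger's stub registry; the two infrastructure stubs
(`stub_cobordantPlus_smooth`, `stub_offExceptional`) are. This file keeps those two (the first VERBATIM, split in
two registered halves; the second with the planner-private predicate `OnExceptional` inlined as membership in
the support of `affineCobordantBlowup.exceptional`), adds the three pieces of scheme theory that axiom `(ii)`
costs ANY construction (`stub_isClosed_singularLocus`, `stub_singularLocus_comap_baseChange`) and the bridge
from the datum file's `extReesAlgebra` to the tree's `IdealFiltration.extendedRees` (`stub_extRees_bridge`), and
re-types the line's content as ONE transfer stub `stub_supportFirstPreDatum : Nonempty (SupportFirstPreDatum p)`: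
a rating of the SINGULAR points of pairs (one well-ordered `Γ`), usc on the singular locus, functorial for smooth
morphisms and perfect ground-field extensions, whose maximum locus carries a regular weighted centre (support FIRST:
the `Aut`-saturated maximum locus; weights SECOND: the support-constrained lexicographic maximum of the card
`Ideas/support-first-weights-second.md`) with the positional drop at the EXCEPTIONAL points of Włodarczyk's `B₊`.
The sorry-free composition `WeightedConstruction_of` builds the datum: `inv := ⊥` at regular points and `↑rate`
at singular ones (axiom `(ii)` by construction), `(usc)`/`(i)` from the pre-datum plus the singular-locus stubs,
`(iv)` off the exceptional divisor from `stub_offExceptional` (there `inv` equals `inv` downstairs at a point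
outside the centre, hence below the maximum) and on it from the pre-datum.

Stubs (7, registered with `ledger skeleton check`):
* `stub_extRees_bridge` [M] — `extReesAlgebra F.ideal = F.extendedRees` for an `IdealFiltration`.
* `stub_cobordantBlowup_regular` [XL] — (bridge ⇒) for a regular weighted centre `R` on a smooth separated
  quasi-compact `Y` over a field and ANY affine open `U`, the full cobordant blow-up
  `Spec (extReesAlgebra (R.chartIdeals U))` is a regular scheme, locally of finite type over `U` (W 2.3.9 +
  locality; tree: `cobordantAlgebra.isRegularRing_of_linearIndependent_toCotangent`,
  `IdealFiltration.isLocalization_away_extendedRees`, `cobordantAlgebra_eq_extendedRees`).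
* `stub_cobordantPlus_smooth` [M] — (previous stub's statement ⇒) the registered T7 signature VERBATIM:
  `B₊(U) → Spec k` smooth, separated, quasi-compact (tree: `smooth_of_isRegular_of_perfectField`).
* `stub_offExceptional` [L] — (bridge ⇒) off the exceptional divisor `inv` on `(B₊(U), strict transform)`
  equals `inv` downstairs, at a point outside the support of the centre (registered support-first signature,
  `OnExceptional` inlined).
* `stub_isClosed_singularLocus` [M] — the singular locus of `X.subscheme`, seen in `Y`, is closed
  (tree: `isOpen_regularLocus_of_locallyOfFiniteType`, `isQuasiExcellentRing_of_field`).
* `stub_singularLocus_comap_baseChange` [L] — singularity of `X` at a point is invariant under smooth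
  `k`-morphisms (`X.comap g`) and under base change to a perfect extension field (tree:
  `isRegularLocalRing_stalk_of_smooth`, `IsRegularLocalRing.of_flat_of_isLocalHom`,
  `RegularLocusPerfectFibreScheme`; Mathlib `Scheme.IdealSheafData.comapIso`).
* `stub_supportFirstPreDatum` [XL, hardest, transfer, the lead's] — `Nonempty (SupportFirstPreDatum p)`.
-/

noncomputable section

open CategoryTheory CategoryTheory.Limits AlgebraicGeometry TopologicalSpace
open Literature.AlgebraicGeometry.Resolution
open Summit.ResolutionOfSingularities.ResolutionOfSingularities.Theses.WeightedInvariant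

set_option linter.dupNamespace false

namespace Summit.ResolutionOfSingularities.ResolutionOfSingularities.Cruxes.WeightedConstruction.SupportFirst

/-! ## Vocabulary -/

/-- `X` is SINGULAR at the point `y` of the ambient scheme: some point of Mathlib's `X.subscheme` lying over
`y` has a non-regular local ring — the negation of the right-hand side of axiom `(ii)` of
`WeightedResolutionDatum`. -/
def XSing {Y : Scheme.{0}} (X : Y.IdealSheafData) (y : Y) : Prop :=
  ∃ x : X.subscheme, X.subschemeι x = y ∧ ¬ IsRegularLocalRing (X.subscheme.presheaf.stalk x)

/-- **Support-first pre-datum in characteristic `p`** (the line's C⁺): a rating `rate` of the pointed pairs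
`(Y ⊇ X ∋ y)` with values in ONE well-ordered type `Γ`, meaningful at the SINGULAR points of `X`
(`XSing X y`), together with a weighted centre, such that: the rating is upper semicontinuous on the singular
locus (`isClosed_superlevel`: superlevel sets are traces of closed sets), functorial for smooth `k`-morphisms
and perfect ground-field extensions at singular points; when `X` has a singular point the centre is a regular
weighted centre supported exactly on the locus of singular points of maximal rating (SUPPORT FIRST), functorial
for smooth surjections and perfect base change; and (WEIGHTS SECOND, the positional drop) at every point `b` of
the EXCEPTIONAL divisor of every cobordant chart `B₊(U)` at which the strict transform is singular, the rating is
strictly below the maximal rating downstairs — stated under the hypotheses that `B₊(U) → Spec k` is smooth,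
separated and quasi-compact (supplied by `stub_cobordantPlus_smooth` in the composition). -/
structure SupportFirstPreDatum (p : ℕ) : Type 1 where
  /-- the value set of the rating (one for all dimensions) -/
  Γ : Type
  /-- `Γ` is linearly ordered … -/
  [linearOrder : LinearOrder Γ]
  /-- … and well-ordered -/
  [wellFoundedLT : WellFoundedLT Γ]
  /-- the rating of a pointed pair (total; meaningful at singular points of `X`, `k` perfect of char `p`,
  `f` smooth separated quasi-compact) -/
  rate : ∀ ⦃k : Type⦄ [Field k] ⦃Y : Scheme.{0}⦄, (Y ⟶ Spec (.of k)) → Y.IdealSheafData → Y → Γ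
  /-- the weighted centre of `(Y, X)` -/
  centre : ∀ ⦃k : Type⦄ [Field k] ⦃Y : Scheme.{0}⦄, (Y ⟶ Spec (.of k)) → Y.IdealSheafData →
    ReesAlgebraData Y
  /-- usc ON THE SINGULAR LOCUS: every superlevel set of `rate` is the trace of a closed subset of `Y` -/
  isClosed_superlevel : ∀ ⦃k : Type⦄ [Field k] [CharP k p] [PerfectField k] ⦃Y : Scheme.{0}⦄
    (f : Y ⟶ Spec (.of k)) [Smooth f] [IsSeparated f] [QuasiCompact f] (X : Y.IdealSheafData)
    (γ : Γ), ∃ C : Set Y, IsClosed C ∧ ∀ y : Y, XSing X y → (y ∈ C ↔ γ ≤ rate f X y)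
  /-- functoriality of `rate` for smooth `k`-morphisms, at singular points -/
  rate_comap : ∀ ⦃k : Type⦄ [Field k] [CharP k p] [PerfectField k] ⦃Y Y₁ : Scheme.{0}⦄
    (f : Y ⟶ Spec (.of k)) [Smooth f] [IsSeparated f] [QuasiCompact f]
    (f₁ : Y₁ ⟶ Spec (.of k)) [Smooth f₁] [IsSeparated f₁] [QuasiCompact f₁]
    (g : Y₁ ⟶ Y) [Smooth g], g ≫ f = f₁ →
    ∀ (X : Y.IdealSheafData) (y₁ : Y₁), XSing X (g y₁) → rate f₁ (X.comap g) y₁ = rate f X (g y₁)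
  /-- functoriality of `rate` for extensions of perfect ground fields, at singular points -/
  rate_baseChange : ∀ ⦃k : Type⦄ [Field k] [CharP k p] [PerfectField k]
    ⦃K : Type⦄ [Field K] [PerfectField K] (φ : k →+* K)
    ⦃Y YK : Scheme.{0}⦄ (f : Y ⟶ Spec (.of k)) [Smooth f] [IsSeparated f] [QuasiCompact f]
    (fK : YK ⟶ Spec (.of K)) (pr : YK ⟶ Y),
    IsPullback pr fK f (Spec.map (CommRingCat.ofHom φ)) →
    ∀ (X : Y.IdealSheafData) (y : YK), XSing X (pr y) → rate fK (X.comap pr) y = rate f X (pr y)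
  /-- SUPPORT FIRST, regularity: when `X` has a singular point the centre is a regular weighted centre … -/
  isRegularWeightedCentre_centre : ∀ ⦃k : Type⦄ [Field k] [CharP k p] [PerfectField k]
    ⦃Y : Scheme.{0}⦄ (f : Y ⟶ Spec (.of k)) [Smooth f] [IsSeparated f] [QuasiCompact f]
    (X : Y.IdealSheafData), (∃ y : Y, XSing X y) → (centre f X).IsRegularWeightedCentre
  /-- … supported exactly on the singular points of maximal rating -/
  support_centre : ∀ ⦃k : Type⦄ [Field k] [CharP k p] [PerfectField k]
    ⦃Y : Scheme.{0}⦄ (f : Y ⟶ Spec (.of k)) [Smooth f] [IsSeparated f] [QuasiCompact f]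
    (X : Y.IdealSheafData), (∃ y : Y, XSing X y) →
    (centre f X).support = {y : Y | XSing X y ∧ ∀ y' : Y, XSing X y' → rate f X y' ≤ rate f X y}
  /-- functoriality of the centre for smooth SURJECTIVE `k`-morphisms -/
  centre_comap : ∀ ⦃k : Type⦄ [Field k] [CharP k p] [PerfectField k] ⦃Y Y₁ : Scheme.{0}⦄
    (f : Y ⟶ Spec (.of k)) [Smooth f] [IsSeparated f] [QuasiCompact f]
    (f₁ : Y₁ ⟶ Spec (.of k)) [Smooth f₁] [IsSeparated f₁] [QuasiCompact f₁]
    (g : Y₁ ⟶ Y) [Smooth g] [Surjective g], g ≫ f = f₁ →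
    ∀ (X : Y.IdealSheafData), (∃ y : Y, XSing X y) →
    ∀ n : ℕ, (centre f₁ (X.comap g)).piece n = ((centre f X).piece n).comap g
  /-- functoriality of the centre for extensions of perfect ground fields -/
  centre_baseChange : ∀ ⦃k : Type⦄ [Field k] [CharP k p] [PerfectField k]
    ⦃K : Type⦄ [Field K] [PerfectField K] (φ : k →+* K)
    ⦃Y YK : Scheme.{0}⦄ (f : Y ⟶ Spec (.of k)) [Smooth f] [IsSeparated f] [QuasiCompact f]
    (fK : YK ⟶ Spec (.of K)) (pr : YK ⟶ Y),
    IsPullback pr fK f (Spec.map (CommRingCat.ofHom φ)) →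
    ∀ (X : Y.IdealSheafData), (∃ y : Y, XSing X y) →
    ∀ n : ℕ, (centre fK (X.comap pr)).piece n = ((centre f X).piece n).comap pr
  /-- WEIGHTS SECOND, the positional drop at the EXCEPTIONAL points of the cobordant blow-up: on every affine
  chart `U`, granted that `B₊(U) → Spec k` is smooth separated quasi-compact, at every point `b` of `B₊(U)`
  lying on the exceptional divisor `V(t⁻¹)` at which the strict transform of `X` is singular, the rating is
  strictly below the rating at any singular point `y` of maximal rating downstairs -/
  rate_exceptional_lt : ∀ ⦃k : Type⦄ [Field k] [CharP k p] [PerfectField k]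
    ⦃Y : Scheme.{0}⦄ (f : Y ⟶ Spec (.of k)) [Smooth f] [IsSeparated f] [QuasiCompact f]
    (X : Y.IdealSheafData), (∃ y : Y, XSing X y) →
    ∀ (U : Y.affineOpens), Smooth ((centre f X).cobordantPlusι U ≫ f) →
      IsSeparated ((centre f X).cobordantPlusι U ≫ f) → QuasiCompact ((centre f X).cobordantPlusι U ≫ f) →
    ∀ (b : (centre f X).cobordantPlus U) (y : Y), XSing X y →
      (∀ y' : Y, XSing X y' → rate f X y' ≤ rate f X y) →
      (affineCobordantBlowup.plusOpens ((centre f X).chartIdeals U)).ι b ∈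
        ((affineCobordantBlowup.exceptional ((centre f X).chartIdeals U)).support :
          Set (affineCobordantBlowup ((centre f X).chartIdeals U))) →
      XSing ((centre f X).cobordantStrictTransform U X) b →
      rate ((centre f X).cobordantPlusι U ≫ f) ((centre f X).cobordantStrictTransform U X) b < rate f X y

/-! ## Stubs -/

/-- `stub_extRees_bridge` [M] — LANDED p96822 (`Theorems.stub_extRees_bridge`): the datum file's extended Rees algebra `Algebra.adjoin A {t⁻¹, a tⁿ : a ∈ Jₙ}`
of a descending multiplicative filtration IS the tree's `IdealFiltration.extendedRees` (Laurent polynomials whose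
coefficient of `tⁿ`, `n ≥ 0`, lies in `Jₙ`): `⊆` because the generators satisfy the coefficient condition and it is
a subalgebra; `⊇` because `a tⁿ` (`a ∈ Jₙ`) and `a t⁻ᵐ` are (products of) generators. -/
theorem stub_extRees_bridge : ∀ (A : Type) [CommRing A] (F : IdealFiltration A),
    extReesAlgebra F.ideal = F.extendedRees :=
  Theorems.stub_extRees_bridge

/-- `stub_cobordantBlowup_regular` [XL] — LANDED p100702 (`Theorems.stub_cobordantBlowup_regular`): Włodarczyk 2.3.9 for the DATUM's charts. Granted the bridge, for a regular
weighted centre `R` (datum sense: `ReesAlgebraData.IsRegularWeightedCentre`) on a smooth separated quasi-compact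
`Y` over a field and ANY affine open `U ⊆ Y`, the full cobordant blow-up `B(U) = Spec Γ(U)[t⁻¹, Rₙ(U) tⁿ]` is a
regular scheme and `B(U) → U` is locally of finite type. Route: `U` is covered by opens that are basic open both
in `U` and in a chart open (`exists_basicOpen_le_affine_inter`); over such an open the filtration is the weighted
filtration of the restricted chart (`Scheme.IdealSheafData.map_ideal_basicOpen`), the extended Rees algebra
localizes (`IdealFiltration.isLocalization_away_extendedRees`) and equals `cobordantAlgebra u w`
(`cobordantAlgebra_eq_extendedRees`), which is regular (`cobordantAlgebra.isRegularRing_of_linearIndependent_toCotangent`,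
the chart's `linearIndependent` read in the stalks `IsAffineOpen.isLocalization_stalk`) and finitely generated. -/
theorem stub_cobordantBlowup_regular :
    (∀ (A : Type) [CommRing A] (F : IdealFiltration A), extReesAlgebra F.ideal = F.extendedRees) →
    ∀ ⦃k : Type⦄ [Field k] ⦃Y : Scheme.{0}⦄ (f : Y ⟶ Spec (.of k)) [Smooth f] [IsSeparated f]
      [QuasiCompact f] (R : ReesAlgebraData Y), R.IsRegularWeightedCentre → ∀ U : Y.affineOpens,
      Scheme.IsRegular (affineCobordantBlowup (R.chartIdeals U)) ∧
        LocallyOfFiniteType (affineCobordantBlowup.π (R.chartIdeals U)) :=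
  Theorems.stub_cobordantBlowup_regular

/-- `stub_cobordantPlus_smooth` [M] — LANDED p96888 (`Theorems.stub_cobordantPlus_smooth`): the registered T7 signature VERBATIM, granted the previous stub's statement:
`B₊(U)` is an open subscheme of the regular `B(U)` (`Scheme.IsRegular.of_isOpenImmersion`), locally of finite type
over the perfect field, hence smooth (`smooth_of_isRegular_of_perfectField`); separated (open immersion, affine
morphism `B(U) → U`, open immersion `U → Y`, `f`); quasi-compact (an open of the Noetherian `B(U)`). -/
theorem stub_cobordantPlus_smooth :
    (∀ ⦃k : Type⦄ [Field k] ⦃Y : Scheme.{0}⦄ (f : Y ⟶ Spec (.of k)) [Smooth f] [IsSeparated f]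
      [QuasiCompact f] (R : ReesAlgebraData Y), R.IsRegularWeightedCentre → ∀ U : Y.affineOpens,
      Scheme.IsRegular (affineCobordantBlowup (R.chartIdeals U)) ∧
        LocallyOfFiniteType (affineCobordantBlowup.π (R.chartIdeals U))) →
    ∀ ⦃k : Type⦄ [Field k] [PerfectField k] ⦃Y : Scheme.{0}⦄ (f : Y ⟶ Spec (.of k)) [Smooth f]
      [IsSeparated f] [QuasiCompact f] (R : ReesAlgebraData Y), R.IsRegularWeightedCentre →
      ∀ U : Y.affineOpens, Smooth (R.cobordantPlusι U ≫ f) ∧ IsSeparated (R.cobordantPlusι U ≫ f) ∧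
        QuasiCompact (R.cobordantPlusι U ≫ f) :=
  Theorems.stub_cobordantPlus_smooth

/-- `stub_offExceptional` [L] — LANDED p99311 (`Theorems.stub_offExceptional`, registered signature: the bridge binder of v1.1 dropped as unused) (registered support-first signature, `OnExceptional` inlined): for ANY
rating `inv` functorial for smooth `k`-morphisms, any Rees algebra `R`, any affine chart `U` with `B₊(U) → Spec k`
smooth separated quasi-compact, and any point `b` of `B₊(U)` OFF the exceptional divisor `V(t⁻¹)`: `inv` of
`(B₊(U), strict transform of X)` at `b` equals `inv` of `(Y, X)` at the image of `b`, and that image is not in the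
support of `R`. Route: `B₊(U) ∖ V(t⁻¹)` is an open of `B(U) ∖ V(t⁻¹) = Spec Γ(U)[t, t⁻¹]` (inverting `t⁻¹` in the
extended Rees algebra), smooth over `U`; the strict transform is the pull-back of `X` there (`t⁻¹` is a unit, so the
saturation `extReesAlgebra.mem_strictTransform_iff` is vacuous); apply `hcomap` to the two smooth legs
`B₊(U) ∖ V(t⁻¹) → B₊(U)` and `B₊(U) ∖ V(t⁻¹) → Y`. Off `V(t⁻¹)` and off the vertex some `a tⁿ` (`a ∈ Rₙ(U)`, `n ≥ 1`)
and `t⁻¹` are both non-zero at `b`, so `a = (a tⁿ)(t⁻¹)ⁿ` is non-zero at the image point, which is then off `V(Rₙ)`. -/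
theorem stub_offExceptional :
    ∀ (p : ℕ) (Γ : Type) (inv : ∀ ⦃k : Type⦄ [Field k] ⦃Y : Scheme.{0}⦄, (Y ⟶ Spec (.of k)) →
      Y.IdealSheafData → Y → Γ),
    (∀ ⦃k : Type⦄ [Field k] [CharP k p] [PerfectField k] ⦃Y Y₁ : Scheme.{0}⦄ (f : Y ⟶ Spec (.of k))
      [Smooth f] [IsSeparated f] [QuasiCompact f] (f₁ : Y₁ ⟶ Spec (.of k)) [Smooth f₁] [IsSeparated f₁]
      [QuasiCompact f₁] (g : Y₁ ⟶ Y) [Smooth g], g ≫ f = f₁ →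
      ∀ (X : Y.IdealSheafData) (y₁ : Y₁), inv f₁ (X.comap g) y₁ = inv f X (g y₁)) →
    ∀ ⦃k : Type⦄ [Field k] [CharP k p] [PerfectField k] ⦃Y : Scheme.{0}⦄ (f : Y ⟶ Spec (.of k))
      [Smooth f] [IsSeparated f] [QuasiCompact f] (X : Y.IdealSheafData) (R : ReesAlgebraData Y)
      (U : Y.affineOpens), Smooth (R.cobordantPlusι U ≫ f) → IsSeparated (R.cobordantPlusι U ≫ f) →
      QuasiCompact (R.cobordantPlusι U ≫ f) → ∀ b : R.cobordantPlus U,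
      (affineCobordantBlowup.plusOpens (R.chartIdeals U)).ι b ∉
        ((affineCobordantBlowup.exceptional (R.chartIdeals U)).support :
          Set (affineCobordantBlowup (R.chartIdeals U))) →
      inv (R.cobordantPlusι U ≫ f) (R.cobordantStrictTransform U X) b = inv f X (R.cobordantPlusι U b) ∧
        R.cobordantPlusι U b ∉ R.support :=
  Theorems.stub_offExceptional

/-- `stub_isClosed_singularLocus` [M] — LANDED p98176 (`Theorems.stub_isClosed_singularLocus`): for a scheme `Y` locally of finite type over a field and an ideal sheaf `X`,
the set of points of `Y` at which `X` is singular is closed: it is the image under the closed immersion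
`X.subschemeι` of the complement of the regular locus of `X.subscheme`, which is open because `X.subscheme` is
locally of finite type over the (quasi-excellent) field (`isClosed_compl_regularLocus_of_locallyOfFiniteType`,
`isQuasiExcellentRing_of_field`). -/
theorem stub_isClosed_singularLocus : ∀ ⦃k : Type⦄ [Field k] ⦃Y : Scheme.{0}⦄ (f : Y ⟶ Spec (.of k))
    [LocallyOfFiniteType f] (X : Y.IdealSheafData),
    IsClosed {y : Y | ∃ x : X.subscheme, X.subschemeι x = y ∧
      ¬ IsRegularLocalRing (X.subscheme.presheaf.stalk x)} :=
  Theorems.stub_isClosed_singularLocus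

/-- `stub_singularLocus_comap_baseChange` [L] — LANDED p97164 (`Theorems.stub_singularLocus_comap_baseChange`): singularity of `X` at a point is invariant (a) under smooth
`k`-morphisms `g : Y₁ → Y` — `(X.comap g).subscheme ≅ Y₁ ×_Y X.subscheme` (`Scheme.IdealSheafData.comapIso`) is
smooth over `X.subscheme`, and along a smooth morphism of locally Noetherian schemes a stalk upstairs is regular iff
the stalk downstairs is (`isRegularLocalRing_stalk_of_smooth`; `IsRegularLocalRing.of_flat_of_isLocalHom`) — and
(b) under base change to a perfect extension field `K` of the perfect ground field `k` — over a perfect field a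
point of a scheme locally of finite type is regular iff it is a smooth point, and smooth points correspond under
base change (`RegularLocusPerfectFibreScheme`, `SmoothLocusBaseChange`; flat descent for the converse). -/
theorem stub_singularLocus_comap_baseChange :
    (∀ ⦃k : Type⦄ [Field k] ⦃Y Y₁ : Scheme.{0}⦄ (f : Y ⟶ Spec (.of k)) [LocallyOfFiniteType f]
      (f₁ : Y₁ ⟶ Spec (.of k)) [LocallyOfFiniteType f₁] (g : Y₁ ⟶ Y) [Smooth g], g ≫ f = f₁ →
      ∀ (X : Y.IdealSheafData) (y₁ : Y₁),
      (∃ x₁ : (X.comap g).subscheme, (X.comap g).subschemeι x₁ = y₁ ∧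
          ¬ IsRegularLocalRing ((X.comap g).subscheme.presheaf.stalk x₁)) ↔
        ∃ x : X.subscheme, X.subschemeι x = g y₁ ∧
          ¬ IsRegularLocalRing (X.subscheme.presheaf.stalk x)) ∧
    (∀ ⦃k : Type⦄ [Field k] [PerfectField k] ⦃K : Type⦄ [Field K] [PerfectField K] (φ : k →+* K)
      ⦃Y YK : Scheme.{0}⦄ (f : Y ⟶ Spec (.of k)) [LocallyOfFiniteType f] (fK : YK ⟶ Spec (.of K))
      (pr : YK ⟶ Y), IsPullback pr fK f (Spec.map (CommRingCat.ofHom φ)) →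
      ∀ (X : Y.IdealSheafData) (y : YK),
      (∃ x' : (X.comap pr).subscheme, (X.comap pr).subschemeι x' = y ∧
          ¬ IsRegularLocalRing ((X.comap pr).subscheme.presheaf.stalk x')) ↔
        ∃ x : X.subscheme, X.subschemeι x = pr y ∧
          ¬ IsRegularLocalRing (X.subscheme.presheaf.stalk x)) :=
  Theorems.stub_singularLocus_comap_baseChange

/-- `stub_supportFirstPreDatum` [XL, hardest, transfer, the lead's]: THE CONSTRUCTION — for every prime `p` a
support-first pre-datum exists. This is the crux minus axiom `(ii)`, minus the off-exceptional half of `(iv)` and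
minus the smoothness of `B₊`; it must survive the standing disprover's tests (`Cruxes/WeightedConstruction/Disproof.lean`
Part III: `false_of_smoothLocalEquivalence`, `not_nonempty_of_isolated_reproduction`, `maxLocus_eq_of_homogeneous`,
`inv_comap_semilinear`). -/
theorem stub_supportFirstPreDatum : ∀ p : ℕ, p.Prime → Nonempty (SupportFirstPreDatum p) := by
  sorry


/-! ## Composition -/

namespace SupportFirstPreDatum

variable {p : ℕ} (D : SupportFirstPreDatum p)

/-- The value set of a pre-datum is linearly ordered (structure field as an instance). -/
instance instLinearOrder : LinearOrder D.Γ := D.linearOrder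

/-- The value set of a pre-datum is well-ordered (structure field as an instance). -/
instance instWellFoundedLT : WellFoundedLT D.Γ := D.wellFoundedLT

open Classical in
/-- The invariant of the datum built from a pre-datum: `⊥` at the points where `X` is regular or absent, the
rating (in `WithBot Γ`) at the singular points — axiom `(ii)` holds by construction. -/
def inv ⦃k : Type⦄ [Field k] ⦃Y : Scheme.{0}⦄ (f : Y ⟶ Spec (.of k)) (X : Y.IdealSheafData) (y : Y) :
    WithBot D.Γ :=
  if XSing X y then (D.rate f X y : WithBot D.Γ) else ⊥

section Basic

variable {k : Type} [Field k] {Y : Scheme.{0}} (f : Y ⟶ Spec (.of k)) (X : Y.IdealSheafData)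

/-- At a singular point the invariant is the rating. -/
theorem inv_of_xSing {y : Y} (h : XSing X y) : D.inv f X y = D.rate f X y := by
  simp [inv, h]

/-- At a regular (or absent) point the invariant is `⊥`. -/
theorem inv_of_not_xSing {y : Y} (h : ¬ XSing X y) : D.inv f X y = ⊥ := by
  simp [inv, h]

/-- The invariant is minimal exactly at the non-singular points. -/
theorem isBot_inv_iff_not_xSing (y : Y) : IsBot (D.inv f X y) ↔ ¬ XSing X y := by
  constructor
  · intro hbot hsing
    rw [D.inv_of_xSing f X hsing] at hbot
    exact WithBot.coe_ne_bot (le_bot_iff.mp (hbot ⊥))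
  · intro h
    rw [D.inv_of_not_xSing f X h]
    exact isBot_bot

/-- The guard of the datum is the existence of a singular point. -/
theorem guard_iff : (∃ y : Y, ¬ IsBot (D.inv f X y)) ↔ ∃ y : Y, XSing X y := by
  simp only [D.isBot_inv_iff_not_xSing f X, not_not]

/-- A superlevel set of the invariant at a non-bottom level is the corresponding superlevel set of the rating
inside the singular locus. -/
theorem coe_le_inv_iff (γ : D.Γ) (y : Y) : (γ : WithBot D.Γ) ≤ D.inv f X y ↔ XSing X y ∧ γ ≤ D.rate f X y := by
  by_cases h : XSing X y
  · rw [D.inv_of_xSing f X h, WithBot.coe_le_coe]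
    exact ⟨fun hle => ⟨h, hle⟩, fun hh => hh.2⟩
  · rw [D.inv_of_not_xSing f X h]
    simp only [h, false_and, iff_false]
    exact fun hle => WithBot.coe_ne_bot (le_bot_iff.mp hle)

/-- The maximum locus of the invariant, when a singular point exists, is the set of singular points of maximal
rating. -/
theorem isMax_inv_iff (hG : ∃ y : Y, XSing X y) (y : Y) :
    (∀ y' : Y, D.inv f X y' ≤ D.inv f X y) ↔
      XSing X y ∧ ∀ y' : Y, XSing X y' → D.rate f X y' ≤ D.rate f X y := by
  obtain ⟨y₀, hy₀⟩ := hG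
  constructor
  · intro h
    have hy : XSing X y := by
      by_contra hy
      have := h y₀
      rw [D.inv_of_xSing f X hy₀, D.inv_of_not_xSing f X hy] at this
      exact WithBot.coe_ne_bot (le_bot_iff.mp this)
    refine ⟨hy, fun y' hy' => ?_⟩
    have := h y'
    rwa [D.inv_of_xSing f X hy', D.inv_of_xSing f X hy, WithBot.coe_le_coe] at this
  · rintro ⟨hy, h⟩ y'
    by_cases hy' : XSing X y'
    · rw [D.inv_of_xSing f X hy', D.inv_of_xSing f X hy, WithBot.coe_le_coe]
      exact h y' hy'
    · rw [D.inv_of_not_xSing f X hy']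
      exact bot_le

end Basic

/-- Axiom `(i)` for the invariant (smooth `k`-morphisms), from `rate_comap` and the invariance of the singular
locus (`stub_singularLocus_comap_baseChange`). -/
theorem inv_comap ⦃k : Type⦄ [Field k] [CharP k p] [PerfectField k] ⦃Y Y₁ : Scheme.{0}⦄
    (f : Y ⟶ Spec (.of k)) [Smooth f] [IsSeparated f] [QuasiCompact f]
    (f₁ : Y₁ ⟶ Spec (.of k)) [Smooth f₁] [IsSeparated f₁] [QuasiCompact f₁]
    (g : Y₁ ⟶ Y) [Smooth g] (hg : g ≫ f = f₁) (X : Y.IdealSheafData) (y₁ : Y₁) :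
    D.inv f₁ (X.comap g) y₁ = D.inv f X (g y₁) := by
  have hiff : XSing (X.comap g) y₁ ↔ XSing X (g y₁) :=
    stub_singularLocus_comap_baseChange.1 f f₁ g hg X y₁
  by_cases h : XSing X (g y₁)
  · rw [D.inv_of_xSing f₁ _ (hiff.mpr h), D.inv_of_xSing f X h, D.rate_comap f f₁ g hg X y₁ h]
  · rw [D.inv_of_not_xSing f₁ _ (fun h' => h (hiff.mp h')), D.inv_of_not_xSing f X h]

/-- Axiom `(i)` for the invariant (perfect ground-field extensions). -/
theorem inv_baseChange ⦃k : Type⦄ [Field k] [CharP k p] [PerfectField k]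
    ⦃K : Type⦄ [Field K] [PerfectField K] (φ : k →+* K)
    ⦃Y YK : Scheme.{0}⦄ (f : Y ⟶ Spec (.of k)) [Smooth f] [IsSeparated f] [QuasiCompact f]
    (fK : YK ⟶ Spec (.of K)) (pr : YK ⟶ Y)
    (hpb : IsPullback pr fK f (Spec.map (CommRingCat.ofHom φ))) (X : Y.IdealSheafData) (y : YK) :
    D.inv fK (X.comap pr) y = D.inv f X (pr y) := by
  have hiff : XSing (X.comap pr) y ↔ XSing X (pr y) :=
    stub_singularLocus_comap_baseChange.2 φ f fK pr hpb X y
  by_cases h : XSing X (pr y)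
  · rw [D.inv_of_xSing fK _ (hiff.mpr h), D.inv_of_xSing f X h, D.rate_baseChange φ f fK pr hpb X y h]
  · rw [D.inv_of_not_xSing fK _ (fun h' => h (hiff.mp h')), D.inv_of_not_xSing f X h]

/-- Axiom `(usc)` for the invariant, from usc of the rating on the singular locus and closedness of the singular
locus (`stub_isClosed_singularLocus`). -/
theorem isClosed_superlevel_inv ⦃k : Type⦄ [Field k] [CharP k p] [PerfectField k] ⦃Y : Scheme.{0}⦄
    (f : Y ⟶ Spec (.of k)) [Smooth f] [IsSeparated f] [QuasiCompact f] (X : Y.IdealSheafData)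
    (γ : WithBot D.Γ) : IsClosed {y : Y | γ ≤ D.inv f X y} := by
  induction γ using WithBot.recBotCoe with
  | bot =>
    have : {y : Y | (⊥ : WithBot D.Γ) ≤ D.inv f X y} = Set.univ :=
      Set.eq_univ_of_forall fun _ => Set.mem_setOf.mpr bot_le
    rw [this]
    exact isClosed_univ
  | coe γ =>
    obtain ⟨C, hC, hCiff⟩ := D.isClosed_superlevel f X γ
    have hS := stub_isClosed_singularLocus f X
    have : {y : Y | (γ : WithBot D.Γ) ≤ D.inv f X y} = {y : Y | XSing X y} ∩ C := by
      ext y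
      simp only [Set.mem_setOf_eq, Set.mem_inter_iff, D.coe_le_inv_iff f X]
      constructor
      · rintro ⟨hs, hle⟩
        exact ⟨hs, (hCiff y hs).mpr hle⟩
      · rintro ⟨hs, hyC⟩
        exact ⟨hs, (hCiff y hs).mp hyC⟩
    rw [this]
    exact hS.inter hC

/-- Axiom `(iv)` for the invariant: smoothness of `B₊(U)` (`stub_cobordantPlus_smooth` ∘
`stub_cobordantBlowup_regular` ∘ `stub_extRees_bridge`), then ON the exceptional divisor the pre-datum's positional
drop and OFF it `stub_offExceptional` (the invariant equals the invariant downstairs at a point off the maximum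
locus). -/
theorem inv_cobordantPlus_lt ⦃k : Type⦄ [Field k] [CharP k p] [PerfectField k] ⦃Y : Scheme.{0}⦄
    (f : Y ⟶ Spec (.of k)) [Smooth f] [IsSeparated f] [QuasiCompact f] (X : Y.IdealSheafData)
    (hG : ∃ y : Y, ¬ IsBot (D.inv f X y)) (U : Y.affineOpens) (b : (D.centre f X).cobordantPlus U) (y : Y)
    (hy : ∀ y' : Y, D.inv f X y' ≤ D.inv f X y) :
    D.inv ((D.centre f X).cobordantPlusι U ≫ f) ((D.centre f X).cobordantStrictTransform U X) b
      < D.inv f X y := by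
  have hG' : ∃ y : Y, XSing X y := (D.guard_iff f X).mp hG
  obtain ⟨hys, hymax⟩ := (D.isMax_inv_iff f X hG' y).mp hy
  -- `B₊(U) → Spec k` is smooth, separated, quasi-compact (T7)
  obtain ⟨hsm, hsep, hqc⟩ := stub_cobordantPlus_smooth (stub_cobordantBlowup_regular stub_extRees_bridge)
    f (D.centre f X) (D.isRegularWeightedCentre_centre f X hG') U
  rw [D.inv_of_xSing f X hys]
  by_cases hb : XSing ((D.centre f X).cobordantStrictTransform U X) b
  · rw [D.inv_of_xSing _ _ hb]
    by_cases hE : (affineCobordantBlowup.plusOpens ((D.centre f X).chartIdeals U)).ι b ∈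
        ((affineCobordantBlowup.exceptional ((D.centre f X).chartIdeals U)).support :
          Set (affineCobordantBlowup ((D.centre f X).chartIdeals U)))
    · -- on the exceptional divisor: the pre-datum's positional drop
      exact WithBot.coe_lt_coe.mpr
        (D.rate_exceptional_lt f X hG' U hsm hsep hqc b y hys hymax hE hb)
    · -- off the exceptional divisor: `inv` equals `inv` downstairs at a point off the maximum locus
      obtain ⟨heq, hnot⟩ := stub_offExceptional p (WithBot D.Γ) D.inv D.inv_comap
        f X (D.centre f X) U hsm hsep hqc b hE
      rw [← D.inv_of_xSing _ _ hb, heq, ← D.inv_of_xSing f X hys]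
      refine lt_of_le_of_ne (hy _) fun habs => hnot ?_
      rw [D.support_centre f X hG']
      exact (D.isMax_inv_iff f X hG' _).mp fun y' => (hy y').trans (le_of_eq habs.symm)
  · rw [D.inv_of_not_xSing _ _ hb]
    exact WithBot.bot_lt_coe _

/-- **The weighted resolution datum of a support-first pre-datum.** -/
def toDatum : WeightedResolutionDatum p where
  Γ := WithBot D.Γ
  inv := D.inv
  centre := D.centre
  isClosed_superlevel := D.isClosed_superlevel_inv
  inv_comap := D.inv_comap
  inv_baseChange := D.inv_baseChange
  isBot_inv_iff := by
    intro k _ _ _ Y f _ _ _ X y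
    rw [D.isBot_inv_iff_not_xSing f X y, XSing]
    push Not
    rfl
  isRegularWeightedCentre_centre := by
    intro k _ _ _ Y f _ _ _ X hG
    exact D.isRegularWeightedCentre_centre f X ((D.guard_iff f X).mp hG)
  support_centre := by
    intro k _ _ _ Y f _ _ _ X hG
    have hG' := (D.guard_iff f X).mp hG
    rw [D.support_centre f X hG']
    ext y
    simp only [Set.mem_setOf_eq]
    exact (D.isMax_inv_iff f X hG' y).symm
  centre_comap := by
    intro k _ _ _ Y Y₁ f _ _ _ f₁ _ _ _ g _ _ hg X hG n
    exact D.centre_comap f f₁ g hg X ((D.guard_iff f X).mp hG) n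
  centre_baseChange := by
    intro k _ _ _ K _ _ φ Y YK f _ _ _ fK pr hpb X hG n
    exact D.centre_baseChange φ f fK pr hpb X ((D.guard_iff f X).mp hG) n
  inv_cobordantPlus_lt := D.inv_cobordantPlus_lt

end SupportFirstPreDatum

/-- The composition as a theorem: a support-first pre-datum yields a weighted resolution datum. -/
theorem nonempty_datum_of_preDatum {p : ℕ} (D : SupportFirstPreDatum p) :
    Nonempty (WeightedResolutionDatum p) := ⟨D.toDatum⟩

namespace SupportFirstPreDatum

end SupportFirstPreDatum

/-- COMPOSITION: the seven stubs give the crux `WeightedConstruction` BY NAME. -/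
theorem WeightedConstruction_of : WeightedConstruction := fun p hp =>
  nonempty_datum_of_preDatum (stub_supportFirstPreDatum p hp).some

end Summit.ResolutionOfSingularities.ResolutionOfSingularities.Cruxes.WeightedConstruction.SupportFirst

end
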